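import Summits.BirchSwinnertonDyer.BirchSwinnertonDyer.Theorems.EisensteinPrimesGoodLatticeAnacongEulerCompSum
import Summits.BirchSwinnertonDyer.BirchSwinnertonDyer.Theorems.EisensteinPrimesGoodLatticeAnacongEulerCompSymmetry
import Summits.BirchSwinnertonDyer.BirchSwinnertonDyer.Theorems.EisensteinPrimesGoodLatticeOmegaPrelims
import Literature.NumberTheory.NumberFields.AdicCompletionIntegersPadicIntOfDegreeOne
import Literature.NumberTheory.DiophantineGeometry.Conductor
import HarnessLib

/-!
# (eq:Euler-comp), the `w ↔ w̄` PAIRING summed: `Σ_{w∈Sf} corr_w = 2·Σ_{ℓ ∣ N_E} corr_{w_ℓ}`, so that 3a-A's conclusion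
# reads `λ(𝓛_E) = 2·(λ(𝓛_φ) + λ(𝓔_{φ,ψ}))` with Castella–Grossi–Lee–Skinner's ONE-place-per-`ℓ` exponent `λ(𝓔)`

Cell `bsd-eis`, width seat `bsd-line-x1-p1-w2` gen 24, crux 2 `GoodLatticeBDPValue` (stmt-BirchSwinnertonDyer-19032), line
`halves` v33N; helper `--supports`, closes no stub. PROVED, no named fact, no `sorry`.

WHY. Castella–Grossi–Lee–Skinner Thm. 2.2.1 carries ONE place `w ∣ 𝔑` of `K` above each `ℓ ∣ N` in
`𝓔_{φ,ψ} = ∏_{ℓ∣N₀N₋} 𝒫_w(φ) · ∏_{ℓ∣N₀N₊} 𝒫_w(ψ)`, and the proof of Thm. 2.2.2 passes to ALL places through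
"`λ(𝒫_w(θ)²) = λ(𝒫_w(θ)) + λ(𝒫_{w̄}(θ))` … complex conjugation acts as inversion on `Γ`" (held text paper:arxiv-2008.02571 p. 12
L104–113), whereas the CONTENT stub 3a-A sums over all `w ∈ Sf`. Gen 24's `…GoodLatticeAnacongEulerCompSum.anacong_conclusion_iff`
turned 3a-A's conclusion into `n = 2·nφ + Σ_{w∈Sf} corr_w`; this file halves the sum: under (Heeg) every `ℓ ∣ N_E` has EXACTLY two
places of `K` above it (the definition of `SatisfiesHeegnerHypothesis`), and `corr_w` is the same at both (gen 23's `w ↔ w̄` symmetry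
for the residual characters and `[Γ:Γ_w]`, κ anticyclotomic), so `Σ_{w∈Sf} corr_w = 2·Σ_{ℓ∣N_E} corr_{w_ℓ}` for ANY choice
`ℓ ↦ w_ℓ ∋ ℓ`. Since `corr_{w_ℓ} = [E split mult. at ℓ]·[Γ:Γ_{w_ℓ}] + [E additive at ℓ]·(λ𝒫_{w_ℓ}(θsub) + λ𝒫_{w_ℓ}(θquot))` is
EXACTLY CGLS's local exponent of `𝓔_{φ,ψ}` at `ℓ` under the congruences of Thm. 2.2.1 (`ℓ ∣ N_±`: the character congruent to
`a_ℓ` drops out against `𝒫_w(E)`, the other contributes `[a_ℓ ℓ ≡ ℓ] = [split]`; `ℓ ∣ N₀`: both stay) — and does NOT depend on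
the labelling `(N₊, N₋)` — 3a-A's displayed identity is, in the kernel, `λ(𝓛_E) = 2·λ(𝓛_φ) + 2·λ(𝓔_{φ,ψ})`: the `λ`-part of
`𝓛_E ≡ u·(𝓔^ι_{φ,ψ})²·(𝓛_φ)²` with (2.16) `λ(𝓛_ψ) = λ(𝓛_φ)`. (For the typer of director key (β): a λ-currency typing of CGLS 2.2.1
«given the datum» needs NO admissible-factorisation quantifier.)

* §1 (generic, any number field) `natCast_mem_and_ne_bot_of_mem_primesOver'`, `exists_two_places_of_ncard_primesOver_eq_two`
  (over the tree's `EisensteinPrimesMuLambda.asIdeal_mem_primesOver_of_natCast_mem`),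
  `natGenerator_under_eq_iff_natCast_mem`, **`sum_filter_natCast_mem_eq_two_mul`**, **`sum_eq_two_mul_sum_primeFactors_of_heegner`**
  — `Σ_{w∈Sf} g w = 2·Σ_{ℓ ∈ N.primeFactors} g(w_ℓ)` for `Sf = {w : N ∈ w}`, (Heeg) for `N`, and `g` constant above each `ℓ`.
* §2 (at 3a-A's binders, κ anticyclotomic) **`corr_eq_of_natCast_mem`** (`corr_w = corr_{w'}` for `w, w' ∋ ℓ`),
  **`sum_corr_eq_two_mul`**, **`anacong_conclusion_iff_two_mul`** (`⟺ n = 2·(nφ + Σ_{ℓ∣N_E} corr_{w_ℓ})`).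

HONEST FRAMING: helper lemmas on the tree's own objects; 0 stubs / cells / labels / tiers move; orphan for -19032 until a
CGLS-2.2.1-shaped typing of 3a-A consumes it; no summit statement, no case of BSD, no crux or stub, no Keller–Yin / CGLS
theorem is proved here.
References: [CastellaGrossiLeeSkinner2022] Thm. 2.2.1 (`𝓔_{φ,ψ}`, one `w ∣ 𝔑` per `ℓ`), proof of Thm. 2.2.2 ((eq:Euler-comp), (2.16));
[GrossLMS1991] §1 (Heegner hypothesis: every `ℓ ∣ N` splits); [NeukirchANT1999] Ch. I §8 (8.2)–(8.3); [KellerYin2024] Thm. 2.2.2 (shape).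
-/

set_option autoImplicit false
set_option linter.dupNamespace false

noncomputable section

open scoped Classical

open NumberField IsDedekindDomain Field WeierstrassCurve
  Literature.NumberTheory.EllipticCurves Literature.NumberTheory.GaloisRepresentations
  Literature.NumberTheory.EllipticCurves.Rank1Residual
  Literature.NumberTheory.EllipticCurves.KellerYin2024
  IsDedekindDomain.HeightOneSpectrum Rat.HeightOneSpectrum

namespace Summit.BirchSwinnertonDyer.BirchSwinnertonDyer.Theorems.GoodLatticeAnacongEulerCompPairing

/-! ## §1 Two places above each `ℓ ∣ N` under (Heeg), and the pairing of a fibre-constant sum -/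

section Generic

variable {K : Type} [Field K] [NumberField K]

/-- A prime of `𝓞 K` over `(ℓ)` contains `ℓ` and is non-zero. [folklore] -/
theorem natCast_mem_and_ne_bot_of_mem_primesOver' {ℓ : ℕ} (hℓ : ℓ.Prime) {Q : Ideal (𝓞 K)}
    (hQ : Q ∈ (Ideal.span {(ℓ : ℤ)}).primesOver (𝓞 K)) : ((ℓ : ℕ) : 𝓞 K) ∈ Q ∧ Q ≠ ⊥ := by
  have h : ((ℓ : ℕ) : ℤ) ∈ Q.under ℤ := hQ.2.over ▸ Ideal.mem_span_singleton_self _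
  rw [Ideal.under_def, Ideal.mem_comap, map_natCast] at h
  refine ⟨h, fun hQbot ↦ ?_⟩
  rw [hQbot, Ideal.mem_bot, Nat.cast_eq_zero] at h
  exact hℓ.ne_zero h

/-- **Exactly two places above a prime with `#{𝔓 ∣ ℓ} = 2`**: there are `v ≠ v'` containing `ℓ` and every place containing
`ℓ` is one of them (tree `EisensteinPrimesMuLambda.asIdeal_mem_primesOver_of_natCast_mem`: a place containing `ℓ` lies over `(ℓ)`).
[cite: NeukirchANT1999, Ch. I §8 (8.3) (two primes above a split prime of a quadratic field)] -/
theorem exists_two_places_of_ncard_primesOver_eq_two {ℓ : ℕ} (hℓ : ℓ.Prime)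
    (h2 : ((Ideal.span {(ℓ : ℤ)}).primesOver (𝓞 K)).ncard = 2) :
    ∃ v v' : HeightOneSpectrum (𝓞 K), v ≠ v' ∧ ((ℓ : ℕ) : 𝓞 K) ∈ v.asIdeal ∧ ((ℓ : ℕ) : 𝓞 K) ∈ v'.asIdeal ∧
      ∀ u : HeightOneSpectrum (𝓞 K), ((ℓ : ℕ) : 𝓞 K) ∈ u.asIdeal → u = v ∨ u = v' := by
  obtain ⟨P, P', hne, hPP'⟩ := Set.ncard_eq_two.mp h2
  have hP : P ∈ (Ideal.span {(ℓ : ℤ)}).primesOver (𝓞 K) := hPP' ▸ Set.mem_insert P {P'}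
  have hP' : P' ∈ (Ideal.span {(ℓ : ℤ)}).primesOver (𝓞 K) := hPP' ▸ Set.mem_insert_of_mem P (Set.mem_singleton P')
  obtain ⟨hℓP, hPbot⟩ := natCast_mem_and_ne_bot_of_mem_primesOver' hℓ hP
  obtain ⟨hℓP', hP'bot⟩ := natCast_mem_and_ne_bot_of_mem_primesOver' hℓ hP'
  refine ⟨⟨P, hP.1, hPbot⟩, ⟨P', hP'.1, hP'bot⟩, fun h ↦ hne (congrArg HeightOneSpectrum.asIdeal h), hℓP, hℓP',
    fun u hu ↦ ?_⟩
  haveI : Fact ℓ.Prime := ⟨hℓ⟩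
  have hu' : u.asIdeal ∈ ({P, P'} : Set (Ideal (𝓞 K))) := hPP' ▸ EisensteinPrimesMuLambda.asIdeal_mem_primesOver_of_natCast_mem hu
  simp only [Set.mem_insert_iff, Set.mem_singleton_iff] at hu'
  rcases hu' with h | h
  · exact Or.inl (HeightOneSpectrum.ext h)
  · exact Or.inr (HeightOneSpectrum.ext h)

/-- **The prime of `ℚ` below `w` is `ℓ` iff `ℓ ∈ w`** (`ℓ` prime): two distinct rational primes in `w` would put `1 ∈ w`.
[folklore] -/
theorem natGenerator_under_eq_iff_natCast_mem {ℓ : ℕ} (hℓ : ℓ.Prime) (w : HeightOneSpectrum (𝓞 K)) :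
    natGenerator (w.under (𝓞 ℚ)) = ℓ ↔ ((ℓ : ℕ) : 𝓞 K) ∈ w.asIdeal := by
  constructor
  · rintro rfl
    exact SelmerAcQuotientCorankLeCurveLocalLambda.natCast_natGenerator_under_mem w
  · intro hw
    by_contra hne
    have hℓ' : (natGenerator (w.under (𝓞 ℚ))).Prime := prime_natGenerator _
    have hnd : ¬ (natGenerator (w.under (𝓞 ℚ)) : ℤ) ∣ (ℓ : ℤ) := by
      intro h
      have h' : natGenerator (w.under (𝓞 ℚ)) ∣ ℓ := by exact_mod_cast h
      exact hne ((Nat.prime_dvd_prime_iff_eq hℓ' hℓ).mp h')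
    have h := SelmerAcQuotientCorankLeCurveLocalLambda.intCast_notMem_of_not_dvd hℓ'
      (SelmerAcQuotientCorankLeCurveLocalLambda.natCast_natGenerator_under_mem w) hnd
    exact h (by exact_mod_cast hw)

/-- **Pairing over one prime.** If `(ℓ)` has exactly two primes in `𝓞 K`, the finite set `Sf` contains every place above
`ℓ`, and `g` takes the same value `g w₀` at all places above `ℓ`, then `Σ_{w ∈ Sf, ℓ ∈ w} g w = 2·g w₀`.
[cite: NeukirchANT1999, Ch. I §8 (8.3)] -/
theorem sum_filter_natCast_mem_eq_two_mul {ℓ : ℕ} (hℓ : ℓ.Prime)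
    (h2 : ((Ideal.span {(ℓ : ℤ)}).primesOver (𝓞 K)).ncard = 2) (Sf : Finset (HeightOneSpectrum (𝓞 K)))
    (hSf : ∀ u : HeightOneSpectrum (𝓞 K), ((ℓ : ℕ) : 𝓞 K) ∈ u.asIdeal → u ∈ Sf)
    (g : HeightOneSpectrum (𝓞 K) → ℕ) (w₀ : HeightOneSpectrum (𝓞 K))
    (hg : ∀ u : HeightOneSpectrum (𝓞 K), ((ℓ : ℕ) : 𝓞 K) ∈ u.asIdeal → g u = g w₀) :
    ∑ w ∈ Sf.filter (fun w ↦ ((ℓ : ℕ) : 𝓞 K) ∈ w.asIdeal), g w = 2 * g w₀ := by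
  obtain ⟨v, v', hvv', hv, hv', hall⟩ := exists_two_places_of_ncard_primesOver_eq_two hℓ h2
  have hfilter : Sf.filter (fun w ↦ ((ℓ : ℕ) : 𝓞 K) ∈ w.asIdeal) = {v, v'} := by
    ext u
    simp only [Finset.mem_filter, Finset.mem_insert, Finset.mem_singleton]
    constructor
    · exact fun h ↦ hall u h.2
    · rintro (rfl | rfl)
      · exact ⟨hSf _ hv, hv⟩
      · exact ⟨hSf _ hv', hv'⟩
  rw [hfilter, Finset.sum_pair hvv', hg v hv, hg v' hv', two_mul]

/-- **The `w ↔ w̄` pairing, summed: `Σ_{w∈Sf} g w = 2·Σ_{ℓ ∣ N} g(w_ℓ)`.** For a number field `K` with the Heegner hypothesis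
for `N ≠ 0` (every `ℓ ∣ N` has exactly two primes above it), `Sf = {w : N ∈ w}`, any `ℓ ↦ w_ℓ` on the prime factors of `N`
with `g u = g w_ℓ` at every place `u` above `ℓ`. (Fibres of `w ↦ ℓ_w`, the prime below `w`, over `N.primeFactors`.)
[cite: GrossLMS1991, §1 (p. 235) (Heegner hypothesis)] [cite: NeukirchANT1999, Ch. I §8 (8.3)] -/
theorem sum_eq_two_mul_sum_primeFactors_of_heegner {N : ℕ} (hH : SatisfiesHeegnerHypothesis N K) (hN : N ≠ 0)
    (Sf : Finset (HeightOneSpectrum (𝓞 K)))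
    (hSf : ∀ w : HeightOneSpectrum (𝓞 K), w ∈ Sf ↔ ((N : ℤ) : 𝓞 K) ∈ w.asIdeal)
    (g : HeightOneSpectrum (𝓞 K) → ℕ) (wl : ℕ → HeightOneSpectrum (𝓞 K))
    (hg : ∀ ℓ ∈ N.primeFactors, ∀ u : HeightOneSpectrum (𝓞 K), ((ℓ : ℕ) : 𝓞 K) ∈ u.asIdeal → g u = g (wl ℓ)) :
    ∑ w ∈ Sf, g w = 2 * ∑ ℓ ∈ N.primeFactors, g (wl ℓ) := by
  have hmaps : ∀ w ∈ Sf, natGenerator (w.under (𝓞 ℚ)) ∈ N.primeFactors := fun w hw ↦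
    Nat.mem_primeFactors.mpr ⟨prime_natGenerator _,
      SelmerAcQuotientCorankLeCurveLocalLambda.natGenerator_under_dvd_of_mem w ((hSf w).mp hw), hN⟩
  rw [← Finset.sum_fiberwise_of_maps_to hmaps, Finset.mul_sum]
  refine Finset.sum_congr rfl fun ℓ hℓ ↦ ?_
  have hℓp : ℓ.Prime := Nat.prime_of_mem_primeFactors hℓ
  have hℓN : ℓ ∣ N := Nat.dvd_of_mem_primeFactors hℓ
  have hfib : Sf.filter (fun w ↦ natGenerator (w.under (𝓞 ℚ)) = ℓ) =
      Sf.filter (fun w ↦ ((ℓ : ℕ) : 𝓞 K) ∈ w.asIdeal) :=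
    Finset.filter_congr fun w _ ↦ natGenerator_under_eq_iff_natCast_mem hℓp w
  rw [hfib]
  refine sum_filter_natCast_mem_eq_two_mul hℓp (hH ℓ hℓp hℓN) Sf (fun u hu ↦ ?_) g (wl ℓ) (hg ℓ hℓ)
  -- a place above `ℓ ∣ N` contains `N`
  rw [hSf]
  obtain ⟨k, hk⟩ := hℓN
  rw [hk, Nat.cast_mul, Int.cast_mul, Int.cast_natCast, Int.cast_natCast]
  exact u.asIdeal.mul_mem_right _ hu

end Generic

/-! ## §2 The correction term of (eq:Euler-comp) is the same at `w` and `w̄`; the halved sum -/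

section Corr

variable {p : ℕ} [hp : Fact p.Prime] {S : Set (PadicAlgCl p)}
  (W : WeierstrassCurve ℚ) [W.IsElliptic] [W.IsGloballyMinimal] (K : Type) [Field K] [NumberField K]

/-- **`corr_w = corr_{w'}` for two places above the same `ℓ`** (`κ` anticyclotomic; 3a-A's hypotheses on `W, p, K`): both
lie over the same place of `ℚ`, `[Γ:Γ_w] = [Γ:Γ_{w'}]` and the residual characters' local `λ`'s agree (gen 23's
`…EulerCompSymmetry.eulerComp_local_eq_of_natCast_mem`). [cite: CastellaGrossiLeeSkinner2022, proof of Thm. 2.2.2 («λ(𝒫_w(θ)²) = λ(𝒫_w(θ)) + λ(𝒫_w̄(θ))»)] -/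
theorem corr_eq_of_natCast_mem (hp2 : 2 < p) (hred : Red W p) (hanom : Anom W p)
    (hlat : ∀ Φ : AddSubgroup (geomTorsion W (p : ℤ)), IsRationalLine W p Φ → ¬ LineUnramifiedAt W p Φ)
    (hK : IsImaginaryQuadratic K) (hHp : SatisfiesHeegnerHypothesis p K) {κ : ZpExtension K p}
    (hκ : κ.IsAnticyclotomic) {θsub θquot : FramedGaloisRep K (padicCoeffIntegers S) 1}
    (h : IsResidualPairOver (W.baseChange K) p θsub θquot) {ℓ : ℕ} (hℓ : ℓ.Prime)
    {w w' : HeightOneSpectrum (𝓞 K)} (hw : ((ℓ : ℕ) : 𝓞 K) ∈ w.asIdeal) (hw' : ((ℓ : ℕ) : 𝓞 K) ∈ w'.asIdeal) :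
    (if W.HasSplitMultiplicativeReductionAt (w.under (𝓞 ℚ)) then numPlacesAbove κ w
      else if W.HasMultiplicativeReductionAt (w.under (𝓞 ℚ)) then 0
      else charLocalLambda S κ θsub w + charLocalLambda S κ θquot w) =
    (if W.HasSplitMultiplicativeReductionAt (w'.under (𝓞 ℚ)) then numPlacesAbove κ w'
      else if W.HasMultiplicativeReductionAt (w'.under (𝓞 ℚ)) then 0
      else charLocalLambda S κ θsub w' + charLocalLambda S κ θquot w') := by
  haveI : Fact ℓ.Prime := ⟨hℓ⟩
  have hu : w.under (𝓞 ℚ) = w'.under (𝓞 ℚ) :=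
    Literature.NumberTheory.NumberFields.under_eq_under_of_natCast_mem K hw hw'
  obtain ⟨hn, -, hs, hq⟩ :=
    GoodLatticeAnacongEulerCompSymmetry.eulerComp_local_eq_of_natCast_mem W K hp2 hred hanom hlat hK hHp hκ h hℓ hw hw'
  rw [hu, hn, hs, hq]

/-- **`Σ_{w∈Sf} corr_w = 2·Σ_{ℓ ∣ N_E} corr_{w_ℓ}`** at 3a-A's binders (`κ` anticyclotomic, (Heeg) for `N_E`), for any choice
`ℓ ↦ w_ℓ ∋ ℓ` on the primes of `N_E` — `λ((𝓔^ι)²) = 2·λ(𝓔)` with CGLS's one place per `ℓ`.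
[cite: CastellaGrossiLeeSkinner2022, Thm. 2.2.1 (𝓔_{φ,ψ}, one w ∣ 𝔑 per ℓ) and proof of Thm. 2.2.2 (eq:Euler-comp)]
[cite: GrossLMS1991, §1 (p. 235) (Heegner hypothesis)] -/
theorem sum_corr_eq_two_mul (hp2 : 2 < p) (hred : Red W p) (hanom : Anom W p)
    (hlat : ∀ Φ : AddSubgroup (geomTorsion W (p : ℤ)), IsRationalLine W p Φ → ¬ LineUnramifiedAt W p Φ)
    (hK : IsImaginaryQuadratic K) (hH : SatisfiesHeegnerHypothesis (W.conductorNorm ℤ) K)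
    (hHp : SatisfiesHeegnerHypothesis p K) {κ : ZpExtension K p} (hκ : κ.IsAnticyclotomic)
    {θsub θquot : FramedGaloisRep K (padicCoeffIntegers S) 1} (h : IsResidualPairOver (W.baseChange K) p θsub θquot)
    (Sf : Finset (HeightOneSpectrum (𝓞 K)))
    (hSf : ∀ w : HeightOneSpectrum (𝓞 K), w ∈ Sf ↔ ((W.conductorNorm ℤ : ℤ) : 𝓞 K) ∈ w.asIdeal)
    (wl : ℕ → HeightOneSpectrum (𝓞 K))
    (hwl : ∀ ℓ ∈ (W.conductorNorm ℤ).primeFactors, ((ℓ : ℕ) : 𝓞 K) ∈ (wl ℓ).asIdeal) :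
    ∑ w ∈ Sf, (if W.HasSplitMultiplicativeReductionAt (w.under (𝓞 ℚ)) then numPlacesAbove κ w
        else if W.HasMultiplicativeReductionAt (w.under (𝓞 ℚ)) then 0
        else charLocalLambda S κ θsub w + charLocalLambda S κ θquot w) =
      2 * ∑ ℓ ∈ (W.conductorNorm ℤ).primeFactors,
        (if W.HasSplitMultiplicativeReductionAt ((wl ℓ).under (𝓞 ℚ)) then numPlacesAbove κ (wl ℓ)
          else if W.HasMultiplicativeReductionAt ((wl ℓ).under (𝓞 ℚ)) then 0
          else charLocalLambda S κ θsub (wl ℓ) + charLocalLambda S κ θquot (wl ℓ)) :=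
  sum_eq_two_mul_sum_primeFactors_of_heegner hH (conductorNorm_pos_holds W).ne' Sf hSf _ wl
    fun ℓ hℓ _ hu ↦ corr_eq_of_natCast_mem W K hp2 hred hanom hlat hK hHp hκ h (Nat.prime_of_mem_primeFactors hℓ) hu
      (hwl ℓ hℓ)

/-- **3a-A's conclusion in CGLS's one-place-per-`ℓ` form**: at the content stub's binders (with `p` good, (Heeg) for `N_E`, `κ`
anticyclotomic) and for any choice `ℓ ↦ w_ℓ ∋ ℓ` on the primes of `N_E`,
`n + Σ_{w∈Sf} curve w = 2·nφ + Σ_{w∈Sf}(char θsub w + char θquot w)  ⟺  n = 2·(nφ + Σ_{ℓ∣N_E} corr_{w_ℓ})`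
— `λ(𝓛_E) = 2·λ(𝓛_φ) + 2·λ(𝓔_{φ,ψ})`, the `λ`-reading of `𝓛_E ≡ u·(𝓔^ι_{φ,ψ})²·(𝓛_φ)²` with (2.16).
[cite: CastellaGrossiLeeSkinner2022, Thm. 2.2.1 and proof of Thm. 2.2.2 ((eq:Euler-comp), (2.16))]
[cite: KellerYin2024, Thm. 2.2.2 (anacong; arXiv:2402.12781v2 TeX L1445–1448) — shape] -/
theorem anacong_conclusion_iff_two_mul (hp2 : 2 < p) (hgood : Good W p) (hred : Red W p) (hanom : Anom W p)
    (hlat : ∀ Φ : AddSubgroup (geomTorsion W (p : ℤ)), IsRationalLine W p Φ → ¬ LineUnramifiedAt W p Φ)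
    (hK : IsImaginaryQuadratic K) (hH : SatisfiesHeegnerHypothesis (W.conductorNorm ℤ) K)
    (hHp : SatisfiesHeegnerHypothesis p K) {κ : ZpExtension K p} (hκ : κ.IsAnticyclotomic)
    {θsub θquot : FramedGaloisRep K (padicCoeffIntegers S) 1} (h : IsResidualPairOver (W.baseChange K) p θsub θquot)
    (Sf : Finset (HeightOneSpectrum (𝓞 K)))
    (hSf : ∀ w : HeightOneSpectrum (𝓞 K), w ∈ Sf ↔ ((W.conductorNorm ℤ : ℤ) : 𝓞 K) ∈ w.asIdeal)
    (wl : ℕ → HeightOneSpectrum (𝓞 K))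
    (hwl : ∀ ℓ ∈ (W.conductorNorm ℤ).primeFactors, ((ℓ : ℕ) : 𝓞 K) ∈ (wl ℓ).asIdeal) (n nφ : ℕ) :
    (n + ∑ w ∈ Sf, curveLocalLambda κ (W.baseChange K) w =
        2 * nφ + ∑ w ∈ Sf, (charLocalLambda S κ θsub w + charLocalLambda S κ θquot w)) ↔
      n = 2 * (nφ + ∑ ℓ ∈ (W.conductorNorm ℤ).primeFactors,
        (if W.HasSplitMultiplicativeReductionAt ((wl ℓ).under (𝓞 ℚ)) then numPlacesAbove κ (wl ℓ)
          else if W.HasMultiplicativeReductionAt ((wl ℓ).under (𝓞 ℚ)) then 0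
          else charLocalLambda S κ θsub (wl ℓ) + charLocalLambda S κ θquot (wl ℓ))) := by
  rw [GoodLatticeAnacongEulerCompSum.anacong_conclusion_iff W K hp2 hgood hred hanom hlat hK hH hHp κ h Sf hSf n nφ,
    sum_corr_eq_two_mul W K hp2 hred hanom hlat hK hH hHp hκ h Sf hSf wl hwl]
  omega

end Corr

end Summit.BirchSwinnertonDyer.BirchSwinnertonDyer.Theorems.GoodLatticeAnacongEulerCompPairing

end
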